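import Summits.BirchSwinnertonDyer.BirchSwinnertonDyer.Theorems.RamifiedSevenEllipticUnitsRubinFormulaZpBsdp
import Summits.BirchSwinnertonDyer.Rank1Residual.PrintCfram.BottomClassIndexLawFiveLeLine
import Summits.BirchSwinnertonDyer.Rank1Residual.PrintCfram.RubinRoadFiveLe
import HarnessLib

set_option linter.dupNamespace false

/-!
# Route `PrintCFram`, crux S3 `BottomClassIndexLawFiveLe` (item stmt-BirchSwinnertonDyer-20372), line
# `relative-anchor-transfer`: THE ANATOMY OF THE TWO STUBS IN THE KERNEL (lead seat `bsd-line-cfram-p1`;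
# THEOREMS ONLY — nothing asserted about any curve, no stub closed, BSD not proved by any of this)

The registered line splits the class-wide analytic ramified Rubin formula
`S_open = X12.O11.RamifiedCMRubinFormulaAtZp W p` (⟺ S3 under GZK, `bottomClassIndexLawFiveLe_iff_rubinFormulaZp_of_GZK`)
into `stub_unitAnchor` (one member `W₀` per `(p, j)` class where `S_open` holds) and `stub_relativeTransfer`
(`S_open W₀ p → S_open W p` between analytic-rank-one members of one class). This file records, sorry-free,
what the two stubs SAY in the tree's own currency:

* §1 (pure logic, fact-free) `forall_rubinFormulaAtZp_iff_anchor_and_transfer` — class-wide `S_open` ⟺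
  anchor ∧ transfer: the split is LOSSLESS (the conjunction is exactly the expired one-stub line
  `rubin-formula-zp5`), and each stub separately follows from class-wide `S_open` (anchor with `W₀ := W`).
* §2 (pointwise, modulo the four refereed facts {modularity, Gross–Zagier I.(7.3), GZK, Cassels} and the typed
  elliptic-unit main-conjecture identity (R-IMC)∃-Zp `X12.O11.RamifiedCMEllipticUnitIMCAtZp`)
  `rubinFormulaAtZp_transfer_iff_bsdp_transfer` — for a pair `(W₀, W)` of analytic-rank-one members the
  transfer `S_open W₀ p → S_open W p` IS `BSD(W₀, p) → BSD(W, p)`: the load-bearing stub is RELATIVE `BSD_p`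
  between rank-one quadratic twists of a CM curve at the prime ramified in the CM field.
* §3 (class-wide) `stubRelativeTransfer_iff_bsdp_transfer`, `stubUnitAnchor_iff_bsdp_anchor` — the registered
  signatures verbatim ⟺ their `BSD_p` readings; `leaf_iff_bsdp_anchor_and_transfer` — the leaf
  `Summit.BirchSwinnertonDyer.WAllCornerFRamifiedFiveLe` ⟺ (one `BSD_p` member per class) ∧ (`BSD_p` moves between
  rank-one members of a class), fact-free; hence (§3, `stubs_iff_leaf`) modulo (R-IMC)∃-Zp on the leaf and the
  four facts, stub 1 ∧ stub 2 ⟺ the leaf itself.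

CONSEQUENCE FOR THE LINE (numbers, not adjectives): the transfer stub is weaker than the crux by exactly one
`BSD_p` witness per class (seven classes: `p ∈ {7 (two orders), 11, 19, 43, 67, 163}`); no relative `BSD_p`
statement between quadratic twists of analytic rank one at a prime of additive (potentially supersingular)
reduction is in print (presearch 2026-08-28: corpus fts+vec, galaxy; nearest: Li–Tian–Yan–Zhu 2025 —
potentially ORDINARY primes only; Kriz 2020 — `p`-converse only; [BKNO] §1.4 — «report elsewhere»).
beyond-print theorem: NO. Supports, does not close, stmt-BirchSwinnertonDyer-20372.

References: [BurungaleKobayashiNakamuraOta2026] arXiv:2608.06879 §1.4, Thm. 3.14 (3), Thm. 7.2 (claim; preprint;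
shape only); [Miller2011LMS] Def. 1.1; [Cassels1965ArithmeticVIII]; [Rubin1991MainConj] Thm. 4.1; cell files
`Theorems/RamifiedSevenEllipticUnitsRubinFormulaZpBsdp.lean`, `Rank1Residual/PrintCfram/RubinRoadFiveLe.lean`,
`Rank1Residual/PrintCfram/BottomClassIndexLawFiveLeLine.lean`, skeleton
`Cruxes/BottomClassIndexLawFiveLe/Lines/relative_anchor_transfer.lean` (sha16 72dde5b866033574).
-/

noncomputable section

open scoped Classical

open WeierstrassCurve Literature.NumberTheory.EllipticCurves Literature.NumberTheory.EllipticCurves.Rank1Residual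
  Summit.BirchSwinnertonDyer.Rank1Residual Summit.BirchSwinnertonDyer.Rank1Residual.X12
  Summit.BirchSwinnertonDyer.Rank1Residual.X12.O11
  Summit.BirchSwinnertonDyer.BirchSwinnertonDyer.Theorems.RamifiedSevenEllipticUnits

namespace Summit.BirchSwinnertonDyer.BirchSwinnertonDyer.Theorems.PrintCFram.RelativeAnchorTransfer

/-! ### §1. Pure logic: class-wide `S_open` ⟺ anchor ∧ transfer (fact-free) -/

/-- **The split is lossless (fact-free).** Class-wide `S_open` on the leaf at `p ≥ 5` holds iff BOTH
registered stubs of the line hold: the anchor (`∃ W₀` same `j`, CM, ramified at `p`, analytic rank one, with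
`S_open W₀ p`) and the transfer (`S_open W₀ p → S_open W p` between analytic-rank-one members of one class).
(→): anchor with `W₀ := W`, transfer by discarding its hypothesis; (←): the skeleton's composition. So
«anchor ∧ transfer» is verbatim as strong as the expired one-stub line `rubin-formula-zp5`.
[cite: BurungaleKobayashiNakamuraOta2026, §1.4 and Thm. 7.2 (arXiv:2608.06879 pp. 8, 41) (the objects; claim; preprint; shape only)] -/
theorem forall_rubinFormulaAtZp_iff_anchor_and_transfer :
    (∀ (W : WeierstrassCurve ℚ) [W.IsElliptic] [W.IsGloballyMinimal] (p : ℕ) [Fact p.Prime],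
      W.HasCM → CMRamified W p → 5 ≤ p → W.analyticRank = 1 → RamifiedCMRubinFormulaAtZp W p) ↔
    ((∀ (W : WeierstrassCurve ℚ) [W.IsElliptic] [W.IsGloballyMinimal] (p : ℕ) [Fact p.Prime],
        W.HasCM → CMRamified W p → 5 ≤ p → W.analyticRank = 1 →
        ∃ (W₀ : WeierstrassCurve ℚ) (_ : W₀.IsElliptic) (_ : W₀.IsGloballyMinimal),
          W₀.HasCM ∧ CMRamified W₀ p ∧ W₀.analyticRank = 1 ∧ W₀.j = W.j ∧ RamifiedCMRubinFormulaAtZp W₀ p) ∧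
      (∀ (W : WeierstrassCurve ℚ) [W.IsElliptic] [W.IsGloballyMinimal] (W₀ : WeierstrassCurve ℚ) [W₀.IsElliptic]
        [W₀.IsGloballyMinimal] (p : ℕ) [Fact p.Prime],
        W.HasCM → CMRamified W p → 5 ≤ p → W.analyticRank = 1 →
        W₀.HasCM → CMRamified W₀ p → W₀.analyticRank = 1 → W₀.j = W.j →
        RamifiedCMRubinFormulaAtZp W₀ p → RamifiedCMRubinFormulaAtZp W p)) := by
  constructor
  · intro h
    exact ⟨fun W _ _ p _ hCM hram h5 hr ↦ ⟨W, ‹_›, ‹_›, hCM, hram, hr, rfl, h W p hCM hram h5 hr⟩,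
      fun W _ _ W₀ _ _ p _ hCM hram h5 hr _ _ _ _ _ ↦ h W p hCM hram h5 hr⟩
  · rintro ⟨hA, hT⟩ W _ _ p _ hCM hram h5 hr
    obtain ⟨W₀, _, _, hCM₀, hram₀, hr₀, hj, h₀⟩ := hA W p hCM hram h5 hr
    exact hT W W₀ p hCM hram h5 hr hCM₀ hram₀ hr₀ hj h₀

/-- **The same lossless split at the level of `BSD_p` (fact-free):** the leaf
`Summit.BirchSwinnertonDyer.WAllCornerFRamifiedFiveLe` (`BSD(W, p)` for every globally minimal CM `W` of
analytic rank one and every CM-ramified `p ≥ 5`) holds iff (anchor) every such `(W, p)` has a member `W₀` of the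
same `j`-class, CM, ramified at `p`, of analytic rank one with `BSD(W₀, p)`, AND (transfer) `BSD_p` passes between
analytic-rank-one members of one class. [cite: Miller2011LMS, Def. 1.1 (arXiv:1010.2431 p. 3)] -/
theorem leaf_iff_bsdp_anchor_and_transfer :
    Summit.BirchSwinnertonDyer.WAllCornerFRamifiedFiveLe ↔
    ((∀ (W : WeierstrassCurve ℚ) [W.IsElliptic] [W.IsGloballyMinimal] (p : ℕ) [Fact p.Prime],
        W.HasCM → CMRamified W p → 5 ≤ p → W.analyticRank = 1 →
        ∃ (W₀ : WeierstrassCurve ℚ) (_ : W₀.IsElliptic) (_ : W₀.IsGloballyMinimal),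
          W₀.HasCM ∧ CMRamified W₀ p ∧ W₀.analyticRank = 1 ∧ W₀.j = W.j ∧ BSDp W₀ p) ∧
      (∀ (W : WeierstrassCurve ℚ) [W.IsElliptic] [W.IsGloballyMinimal] (W₀ : WeierstrassCurve ℚ) [W₀.IsElliptic]
        [W₀.IsGloballyMinimal] (p : ℕ) [Fact p.Prime],
        W.HasCM → CMRamified W p → 5 ≤ p → W.analyticRank = 1 →
        W₀.HasCM → CMRamified W₀ p → W₀.analyticRank = 1 → W₀.j = W.j → BSDp W₀ p → BSDp W p)) := by
  constructor
  · intro h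
    exact ⟨fun W _ _ p _ hCM hram h5 hr ↦ ⟨W, ‹_›, ‹_›, hCM, hram, hr, rfl, h W p h5 hCM hr hram⟩,
      fun W _ _ W₀ _ _ p _ hCM hram h5 hr _ _ _ _ _ ↦ h W p h5 hCM hr hram⟩
  · rintro ⟨hA, hT⟩ W _ _ p _ h5 hCM hr hram
    obtain ⟨W₀, _, _, hCM₀, hram₀, hr₀, hj, h₀⟩ := hA W p hCM hram h5 hr
    exact hT W W₀ p hCM hram h5 hr hCM₀ hram₀ hr₀ hj h₀

/-! ### §2. Pointwise: the transfer between two members IS relative `BSD_p` (modulo (R-IMC)∃-Zp and the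
four refereed facts) -/

section Pointwise

variable {W W₀ : WeierstrassCurve ℚ} [W.IsElliptic] [W.IsGloballyMinimal] [W₀.IsElliptic] [W₀.IsGloballyMinimal]
  {p : ℕ} [Fact p.Prime]

/-- **Relative `BSD_p` ⟹ the transfer of `S_open`**, for a pair of globally minimal curves of analytic rank one
with `W₀` CM and CM-ramified at `p ≥ 5`, granted (R-IMC)∃-Zp at `W₀` and {modularity, GZ I.(7.3), GZK, Cassels}:
`S_open W₀ p` gives `BSD(W₀, p)` (`bsdp_of_ramifiedCMRubinFormulaAtZp_of_imcZp`), the hypothesis moves it to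
`BSD(W, p)`, and `BSD(W, p)` gives `S_open W p` with no main-conjecture input (`ramifiedCMRubinFormulaAtZp_of_bsdp`).
[cite: Miller2011LMS, Def. 1.1 (arXiv:1010.2431 p. 3)]
[cite: BurungaleKobayashiNakamuraOta2026, Thm. 3.14 (3), Thm. 7.2 and §1.4 (arXiv:2608.06879; claim; preprint; shape only)] -/
theorem rubinFormulaAtZp_transfer_of_bsdp_transfer (hmod : hasEntireLFunction_rat)
    (hGZ : GrossZagier1986_thm_I_7_3) (hGZK : rank_eq_analyticRank_of_analyticRank_le_one)
    (hCassels : bsdRHS_eq_of_isIsogenous) (hIMC₀ : RamifiedCMEllipticUnitIMCAtZp W₀ p) (hCM₀ : W₀.HasCM)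
    (hram₀ : CMRamified W₀ p) (h5 : 5 ≤ p) (hr₀ : W₀.analyticRank = 1) (hr : W.analyticRank = 1)
    (hT : BSDp W₀ p → BSDp W p) :
    RamifiedCMRubinFormulaAtZp W₀ p → RamifiedCMRubinFormulaAtZp W p :=
  fun h₀ ↦ RubinFormulaZpBsdp.ramifiedCMRubinFormulaAtZp_of_bsdp hCassels hmod hGZK hr.le
    (hT (RubinFormulaZpBsdp.bsdp_of_ramifiedCMRubinFormulaAtZp_of_imcZp hmod hGZ hGZK hCassels hIMC₀ hCM₀
      hram₀ h5 hr₀ h₀))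

/-- **The transfer of `S_open` ⟹ relative `BSD_p`**, for a pair of globally minimal curves of analytic rank one
with `W` CM and CM-ramified at `p ≥ 5`, granted (R-IMC)∃-Zp at `W` and {modularity, GZ I.(7.3), GZK, Cassels}:
`BSD(W₀, p)` gives `S_open W₀ p` (no main-conjecture input), the hypothesis moves it to `S_open W p`, and
(R-IMC)∃-Zp at `W` turns that into `BSD(W, p)`. [cite: Miller2011LMS, Def. 1.1 (arXiv:1010.2431 p. 3)]
[cite: BurungaleKobayashiNakamuraOta2026, Thm. 3.14 (3), Thm. 7.2 and §1.4 (arXiv:2608.06879; claim; preprint; shape only)] -/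
theorem bsdp_transfer_of_rubinFormulaAtZp_transfer (hmod : hasEntireLFunction_rat)
    (hGZ : GrossZagier1986_thm_I_7_3) (hGZK : rank_eq_analyticRank_of_analyticRank_le_one)
    (hCassels : bsdRHS_eq_of_isIsogenous) (hIMC : RamifiedCMEllipticUnitIMCAtZp W p) (hCM : W.HasCM)
    (hram : CMRamified W p) (h5 : 5 ≤ p) (hr : W.analyticRank = 1) (hr₀ : W₀.analyticRank = 1)
    (hT : RamifiedCMRubinFormulaAtZp W₀ p → RamifiedCMRubinFormulaAtZp W p) :
    BSDp W₀ p → BSDp W p :=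
  fun hB₀ ↦ RubinFormulaZpBsdp.bsdp_of_ramifiedCMRubinFormulaAtZp_of_imcZp hmod hGZ hGZK hCassels hIMC hCM
    hram h5 hr (hT (RubinFormulaZpBsdp.ramifiedCMRubinFormulaAtZp_of_bsdp hCassels hmod hGZK hr₀.le hB₀))

/-- **The transfer between two members IS relative `BSD_p`.** For globally minimal CM curves `W₀`, `W` of
analytic rank one, both CM-ramified at `p ≥ 5` (the situation of `stub_relativeTransfer`; the hypothesis
`W₀.j = W.j` of the stub is not even needed for this reading), granted (R-IMC)∃-Zp at both and {modularity,
GZ I.(7.3), GZK, Cassels}: `(S_open W₀ p → S_open W p) ↔ (BSD(W₀, p) → BSD(W, p))`. So the load-bearing stub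
is, member by member, the RELATIVE `p`-part of BSD between two rank-one members; a proof of it at a pair where
`BSD(W₀, p)` is certified is a proof of `BSD(W, p)`. [cite: Miller2011LMS, Def. 1.1 (arXiv:1010.2431 p. 3)]
[cite: BurungaleKobayashiNakamuraOta2026, Thm. 3.14 (3), Thm. 7.2 and §1.4 (arXiv:2608.06879; claim; preprint; shape only)] -/
theorem rubinFormulaAtZp_transfer_iff_bsdp_transfer (hmod : hasEntireLFunction_rat)
    (hGZ : GrossZagier1986_thm_I_7_3) (hGZK : rank_eq_analyticRank_of_analyticRank_le_one)
    (hCassels : bsdRHS_eq_of_isIsogenous) (hIMC₀ : RamifiedCMEllipticUnitIMCAtZp W₀ p)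
    (hIMC : RamifiedCMEllipticUnitIMCAtZp W p) (hCM₀ : W₀.HasCM) (hram₀ : CMRamified W₀ p) (hCM : W.HasCM)
    (hram : CMRamified W p) (h5 : 5 ≤ p) (hr₀ : W₀.analyticRank = 1) (hr : W.analyticRank = 1) :
    (RamifiedCMRubinFormulaAtZp W₀ p → RamifiedCMRubinFormulaAtZp W p) ↔ (BSDp W₀ p → BSDp W p) :=
  ⟨bsdp_transfer_of_rubinFormulaAtZp_transfer hmod hGZ hGZK hCassels hIMC hCM hram h5 hr hr₀,
    rubinFormulaAtZp_transfer_of_bsdp_transfer hmod hGZ hGZK hCassels hIMC₀ hCM₀ hram₀ h5 hr₀ hr⟩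

/-- **The anchor at one member IS `BSD_p` at that member** (the pointwise reading of `stub_unitAnchor`'s last
conjunct), granted (R-IMC)∃-Zp there and the four facts: cell `bsd-cm`'s `ramifiedCMRubinFormulaAtZp_iff_bsdp_of_imcZp`,
restated here so that both stubs are read in one place. [cite: Miller2011LMS, Def. 1.1 (arXiv:1010.2431 p. 3)] -/
theorem rubinFormulaAtZp_iff_bsdp (hmod : hasEntireLFunction_rat) (hGZ : GrossZagier1986_thm_I_7_3)
    (hGZK : rank_eq_analyticRank_of_analyticRank_le_one) (hCassels : bsdRHS_eq_of_isIsogenous)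
    (hIMC₀ : RamifiedCMEllipticUnitIMCAtZp W₀ p) (hCM₀ : W₀.HasCM) (hram₀ : CMRamified W₀ p) (h5 : 5 ≤ p)
    (hr₀ : W₀.analyticRank = 1) : RamifiedCMRubinFormulaAtZp W₀ p ↔ BSDp W₀ p :=
  RubinFormulaZpBsdp.ramifiedCMRubinFormulaAtZp_iff_bsdp_of_imcZp hmod hGZ hGZK hCassels hIMC₀ hCM₀ hram₀ h5 hr₀

end Pointwise

/-! ### §3. Class-wide: the registered signatures verbatim ⟺ their `BSD_p` readings; stubs ⟺ leaf -/

/-- **`stub_relativeTransfer` (its registered signature, verbatim) ⟺ «`BSD_p` passes between analytic-rank-one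
members of one `(p, j)` class»**, granted (R-IMC)∃-Zp on the leaf (the shape of `RubinRoadFiveLe`'s `hIMC`,
item r9 territory) and {modularity, GZ I.(7.3), GZK, Cassels}. The research content of the load-bearing stub
is therefore RELATIVE `BSD_p` inside the seven twist classes — no easier in kind than `BSD_p` itself unless a
genuinely relative mechanism exists (none in print at a ramified prime). [cite: Miller2011LMS, Def. 1.1 (arXiv:1010.2431 p. 3)]
[cite: BurungaleKobayashiNakamuraOta2026, Thm. 3.14 (3) and §1.4 (arXiv:2608.06879; claim; preprint; shape only)] -/
theorem stubRelativeTransfer_iff_bsdp_transfer (hmod : hasEntireLFunction_rat)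
    (hGZ : GrossZagier1986_thm_I_7_3) (hGZK : rank_eq_analyticRank_of_analyticRank_le_one)
    (hCassels : bsdRHS_eq_of_isIsogenous)
    (hIMC : ∀ (W : WeierstrassCurve ℚ) [W.IsElliptic] [W.IsGloballyMinimal] (p : ℕ) [Fact p.Prime],
      5 ≤ p → W.HasCM → W.analyticRank = 1 → CMRamified W p → RamifiedCMEllipticUnitIMCAtZp W p) :
    (∀ (W : WeierstrassCurve ℚ) [W.IsElliptic] [W.IsGloballyMinimal] (W₀ : WeierstrassCurve ℚ) [W₀.IsElliptic]
        [W₀.IsGloballyMinimal] (p : ℕ) [Fact p.Prime],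
        W.HasCM → CMRamified W p → 5 ≤ p → W.analyticRank = 1 →
        W₀.HasCM → CMRamified W₀ p → W₀.analyticRank = 1 → W₀.j = W.j →
        RamifiedCMRubinFormulaAtZp W₀ p → RamifiedCMRubinFormulaAtZp W p) ↔
    (∀ (W : WeierstrassCurve ℚ) [W.IsElliptic] [W.IsGloballyMinimal] (W₀ : WeierstrassCurve ℚ) [W₀.IsElliptic]
        [W₀.IsGloballyMinimal] (p : ℕ) [Fact p.Prime],
        W.HasCM → CMRamified W p → 5 ≤ p → W.analyticRank = 1 →
        W₀.HasCM → CMRamified W₀ p → W₀.analyticRank = 1 → W₀.j = W.j → BSDp W₀ p → BSDp W p) := by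
  constructor
  · intro hT W _ _ W₀ _ _ p _ hCM hram h5 hr hCM₀ hram₀ hr₀ hj
    exact bsdp_transfer_of_rubinFormulaAtZp_transfer hmod hGZ hGZK hCassels (hIMC W p h5 hCM hr hram) hCM hram
      h5 hr hr₀ (hT W W₀ p hCM hram h5 hr hCM₀ hram₀ hr₀ hj)
  · intro hT W _ _ W₀ _ _ p _ hCM hram h5 hr hCM₀ hram₀ hr₀ hj
    exact rubinFormulaAtZp_transfer_of_bsdp_transfer hmod hGZ hGZK hCassels (hIMC W₀ p h5 hCM₀ hr₀ hram₀) hCM₀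
      hram₀ h5 hr₀ hr (hT W W₀ p hCM hram h5 hr hCM₀ hram₀ hr₀ hj)

/-- **`stub_unitAnchor` (its registered signature, verbatim) ⟺ «every `(p, j)` class on the leaf has an
analytic-rank-one member `W₀` with `BSD(W₀, p)`»**, granted (R-IMC)∃-Zp on the leaf and {modularity, GZ I.(7.3),
GZK, Cassels}. (Seven classes; the intended witnesses are unit members, where `BSD(W₀, p)` reads
`p ∤ #Ш(W₀)` given `ord_p #Ш_an(W₀) = 0` — Route U's stratum pattern at `p = 7`.)
[cite: Miller2011LMS, Def. 1.1 (arXiv:1010.2431 p. 3)]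
[cite: BurungaleKobayashiNakamuraOta2026, Thm. 3.14 (3) and §1.4 (arXiv:2608.06879; claim; preprint; shape only)] -/
theorem stubUnitAnchor_iff_bsdp_anchor (hmod : hasEntireLFunction_rat)
    (hGZ : GrossZagier1986_thm_I_7_3) (hGZK : rank_eq_analyticRank_of_analyticRank_le_one)
    (hCassels : bsdRHS_eq_of_isIsogenous)
    (hIMC : ∀ (W : WeierstrassCurve ℚ) [W.IsElliptic] [W.IsGloballyMinimal] (p : ℕ) [Fact p.Prime],
      5 ≤ p → W.HasCM → W.analyticRank = 1 → CMRamified W p → RamifiedCMEllipticUnitIMCAtZp W p) :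
    (∀ (W : WeierstrassCurve ℚ) [W.IsElliptic] [W.IsGloballyMinimal] (p : ℕ) [Fact p.Prime],
        W.HasCM → CMRamified W p → 5 ≤ p → W.analyticRank = 1 →
        ∃ (W₀ : WeierstrassCurve ℚ) (_ : W₀.IsElliptic) (_ : W₀.IsGloballyMinimal),
          W₀.HasCM ∧ CMRamified W₀ p ∧ W₀.analyticRank = 1 ∧ W₀.j = W.j ∧ RamifiedCMRubinFormulaAtZp W₀ p) ↔
    (∀ (W : WeierstrassCurve ℚ) [W.IsElliptic] [W.IsGloballyMinimal] (p : ℕ) [Fact p.Prime],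
        W.HasCM → CMRamified W p → 5 ≤ p → W.analyticRank = 1 →
        ∃ (W₀ : WeierstrassCurve ℚ) (_ : W₀.IsElliptic) (_ : W₀.IsGloballyMinimal),
          W₀.HasCM ∧ CMRamified W₀ p ∧ W₀.analyticRank = 1 ∧ W₀.j = W.j ∧ BSDp W₀ p) := by
  constructor
  · intro hA W _ _ p _ hCM hram h5 hr
    obtain ⟨W₀, _, _, hCM₀, hram₀, hr₀, hj, h₀⟩ := hA W p hCM hram h5 hr
    exact ⟨W₀, ‹_›, ‹_›, hCM₀, hram₀, hr₀, hj,
      (rubinFormulaAtZp_iff_bsdp hmod hGZ hGZK hCassels (hIMC W₀ p h5 hCM₀ hr₀ hram₀) hCM₀ hram₀ h5 hr₀).1 h₀⟩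
  · intro hA W _ _ p _ hCM hram h5 hr
    obtain ⟨W₀, _, _, hCM₀, hram₀, hr₀, hj, h₀⟩ := hA W p hCM hram h5 hr
    exact ⟨W₀, ‹_›, ‹_›, hCM₀, hram₀, hr₀, hj,
      (rubinFormulaAtZp_iff_bsdp hmod hGZ hGZK hCassels (hIMC W₀ p h5 hCM₀ hr₀ hram₀) hCM₀ hram₀ h5 hr₀).2 h₀⟩

/-- **Stub 1 ∧ stub 2 (verbatim) ⟺ the leaf `WAllCornerFRamifiedFiveLe`**, granted (R-IMC)∃-Zp on the leaf and
{modularity, GZ I.(7.3), GZK, Cassels}: the line's two stubs together are, in the kernel, exactly the `p ≥ 5` slice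
of partition row 12r (`BSD(W, p)` for every CM `W` of analytic rank one at every CM-ramified `p ≥ 5`). Proof:
§1 (lossless split) + cell `bsd-cm`'s `S_open ↔ BSD(W, p)` pointwise. Nothing is asserted about either side.
[cite: Miller2011LMS, §1 and Def. 1.1 (arXiv:1010.2431 p. 3)]
[cite: BurungaleKobayashiNakamuraOta2026, Thm. 3.14 (3), Thm. 7.2 and §1.4 (arXiv:2608.06879; claim; preprint; shape only)] -/
theorem stubs_iff_leaf (hmod : hasEntireLFunction_rat) (hGZ : GrossZagier1986_thm_I_7_3)
    (hGZK : rank_eq_analyticRank_of_analyticRank_le_one) (hCassels : bsdRHS_eq_of_isIsogenous)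
    (hIMC : ∀ (W : WeierstrassCurve ℚ) [W.IsElliptic] [W.IsGloballyMinimal] (p : ℕ) [Fact p.Prime],
      5 ≤ p → W.HasCM → W.analyticRank = 1 → CMRamified W p → RamifiedCMEllipticUnitIMCAtZp W p) :
    ((∀ (W : WeierstrassCurve ℚ) [W.IsElliptic] [W.IsGloballyMinimal] (p : ℕ) [Fact p.Prime],
        W.HasCM → CMRamified W p → 5 ≤ p → W.analyticRank = 1 →
        ∃ (W₀ : WeierstrassCurve ℚ) (_ : W₀.IsElliptic) (_ : W₀.IsGloballyMinimal),
          W₀.HasCM ∧ CMRamified W₀ p ∧ W₀.analyticRank = 1 ∧ W₀.j = W.j ∧ RamifiedCMRubinFormulaAtZp W₀ p) ∧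
      (∀ (W : WeierstrassCurve ℚ) [W.IsElliptic] [W.IsGloballyMinimal] (W₀ : WeierstrassCurve ℚ) [W₀.IsElliptic]
        [W₀.IsGloballyMinimal] (p : ℕ) [Fact p.Prime],
        W.HasCM → CMRamified W p → 5 ≤ p → W.analyticRank = 1 →
        W₀.HasCM → CMRamified W₀ p → W₀.analyticRank = 1 → W₀.j = W.j →
        RamifiedCMRubinFormulaAtZp W₀ p → RamifiedCMRubinFormulaAtZp W p)) ↔
    Summit.BirchSwinnertonDyer.WAllCornerFRamifiedFiveLe := by
  rw [← forall_rubinFormulaAtZp_iff_anchor_and_transfer]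
  constructor
  · intro h W _ _ p _ h5 hCM hr hram
    exact RubinFormulaZpBsdp.bsdp_of_ramifiedCMRubinFormulaAtZp_of_imcZp hmod hGZ hGZK hCassels
      (hIMC W p h5 hCM hr hram) hCM hram h5 hr (h W p hCM hram h5 hr)
  · intro h W _ _ p _ hCM hram h5 hr
    exact RubinFormulaZpBsdp.ramifiedCMRubinFormulaAtZp_of_bsdp hCassels hmod hGZK hr.le (h W p h5 hCM hr hram)

/-- **The leaf alone gives BOTH stubs (no main-conjecture input)**, granted Cassels, modularity, GZK:
`BSD(W, p)` on the leaf ⟹ class-wide `S_open` (`ramifiedCMRubinFormulaAtZp_of_bsdp` pointwise) ⟹ anchor ∧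
transfer (§1). So neither stub is stronger than the leaf; a refutation of either would refute `BSD(W, p)` for a
CM curve of analytic rank one. [cite: Miller2011LMS, §1 and Def. 1.1 (arXiv:1010.2431 p. 3)] [cite: Cassels1965ArithmeticVIII] -/
theorem stubs_of_leaf (hCassels : bsdRHS_eq_of_isIsogenous) (hmod : hasEntireLFunction_rat)
    (hGZK : rank_eq_analyticRank_of_analyticRank_le_one) (hLeaf : Summit.BirchSwinnertonDyer.WAllCornerFRamifiedFiveLe) :
    (∀ (W : WeierstrassCurve ℚ) [W.IsElliptic] [W.IsGloballyMinimal] (p : ℕ) [Fact p.Prime],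
        W.HasCM → CMRamified W p → 5 ≤ p → W.analyticRank = 1 →
        ∃ (W₀ : WeierstrassCurve ℚ) (_ : W₀.IsElliptic) (_ : W₀.IsGloballyMinimal),
          W₀.HasCM ∧ CMRamified W₀ p ∧ W₀.analyticRank = 1 ∧ W₀.j = W.j ∧ RamifiedCMRubinFormulaAtZp W₀ p) ∧
      (∀ (W : WeierstrassCurve ℚ) [W.IsElliptic] [W.IsGloballyMinimal] (W₀ : WeierstrassCurve ℚ) [W₀.IsElliptic]
        [W₀.IsGloballyMinimal] (p : ℕ) [Fact p.Prime],
        W.HasCM → CMRamified W p → 5 ≤ p → W.analyticRank = 1 →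
        W₀.HasCM → CMRamified W₀ p → W₀.analyticRank = 1 → W₀.j = W.j →
        RamifiedCMRubinFormulaAtZp W₀ p → RamifiedCMRubinFormulaAtZp W p) :=
  forall_rubinFormulaAtZp_iff_anchor_and_transfer.1 fun W _ _ p _ hCM hram h5 hr ↦
    RubinFormulaZpBsdp.ramifiedCMRubinFormulaAtZp_of_bsdp hCassels hmod hGZK hr.le (hLeaf W p h5 hCM hr hram)

/-- **… and the crux S3 itself gives both stubs under its own antecedent GZK (fact-free otherwise):**
`BottomClassIndexLawFiveLe → GZK → anchor ∧ transfer`, by `rubinFormulaZp_of_bottomClassIndexLawFiveLe` and §1.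
The converse (anchor ∧ transfer ⟹ S3) is the registered skeleton's composition `BottomClassIndexLawFiveLe_of`
(there the GZK antecedent of S3 is discarded). [cite: Miller2011LMS, Def. 1.1 (arXiv:1010.2431 p. 3)] [cite: Kolyvagin1990, Thm. A] -/
theorem stubs_of_crux (h : Summit.BirchSwinnertonDyer.BirchSwinnertonDyer.Theses.PrintCFram.BottomClassIndexLawFiveLe)
    (hGZK : rank_eq_analyticRank_of_analyticRank_le_one) :
    (∀ (W : WeierstrassCurve ℚ) [W.IsElliptic] [W.IsGloballyMinimal] (p : ℕ) [Fact p.Prime],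
        W.HasCM → CMRamified W p → 5 ≤ p → W.analyticRank = 1 →
        ∃ (W₀ : WeierstrassCurve ℚ) (_ : W₀.IsElliptic) (_ : W₀.IsGloballyMinimal),
          W₀.HasCM ∧ CMRamified W₀ p ∧ W₀.analyticRank = 1 ∧ W₀.j = W.j ∧ RamifiedCMRubinFormulaAtZp W₀ p) ∧
      (∀ (W : WeierstrassCurve ℚ) [W.IsElliptic] [W.IsGloballyMinimal] (W₀ : WeierstrassCurve ℚ) [W₀.IsElliptic]
        [W₀.IsGloballyMinimal] (p : ℕ) [Fact p.Prime],
        W.HasCM → CMRamified W p → 5 ≤ p → W.analyticRank = 1 →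
        W₀.HasCM → CMRamified W₀ p → W₀.analyticRank = 1 → W₀.j = W.j →
        RamifiedCMRubinFormulaAtZp W₀ p → RamifiedCMRubinFormulaAtZp W p) :=
  forall_rubinFormulaAtZp_iff_anchor_and_transfer.1
    (Summit.BirchSwinnertonDyer.Rank1Residual.PrintCfram.rubinFormulaZp_of_bottomClassIndexLawFiveLe h hGZK)

end Summit.BirchSwinnertonDyer.BirchSwinnertonDyer.Theorems.PrintCFram.RelativeAnchorTransfer

end
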